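import Mathlib
import Literature.Computability.AlgebraicComplexity.EquivariantDC
import Literature.Computability.AlgebraicComplexity.StandardFamilies
import Literature.Computability.AlgebraicComplexity.LandsbergRessayreNormalForm
import Literature.Computability.AlgebraicComplexity.LandsbergRessayreProofs
import Literature.Computability.AlgebraicComplexity.LRLiftCharacter
import Literature.Computability.AlgebraicComplexity.LRFullLifts
import Literature.Computability.AlgebraicComplexity.LRPencilOfMatrix
import Literature.Computability.AlgebraicComplexity.LR21Datum
import Literature.Computability.AlgebraicComplexity.GenericTorusGrading
import Literature.Computability.AlgebraicComplexity.DetReprEquivalent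
import Literature.Computability.AlgebraicComplexity.VonZurGathenSingPermHeight
import Summits.ValiantsHypothesis.ValiantsHypothesis.Theorems.RigidityForcesSymmetryPairTiedTorusBoundDefs
import Summits.ValiantsHypothesis.ValiantsHypothesis.Theorems.RigidityForcesSymmetryRankRigidMinimalReprPathExpansion
import Summits.ValiantsHypothesis.ValiantsHypothesis.Theorems.RigidityForcesSymmetryRankRigidMinimalReprSpectralGauge
import Summits.ValiantsHypothesis.ValiantsHypothesis.Theorems.RigidityForcesSymmetryRankRigidMinimalReprLaplaceOptimalSmall
import Summits.ValiantsHypothesis.ValiantsHypothesis.Theorems.RigidityForcesSymmetryRankRigidMinimalReprTiedTorusBoundOfLevelDecomp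
import Summits.ValiantsHypothesis.ValiantsHypothesis.Theorems.FreeSubtorusOrbitDimensionBoundPerInvariantLevelNodes

/-!
# Crux `OrbitDimensionBound` (stmt-ValiantsHypothesis-16133), line `affine_multiple` — registered stub
# `stub_perInvariantTorusBound`: Grenet's bound on the PER-INVARIANT torus `T¹ = {diag(d_k e_l) : ∏ d ∏ e = 1}`

Route `ValiantsHypothesis/FreeSubtorus`, crux `OrbitDimensionBound` (stmt-16133), registered skeleton
`Cruxes/OrbitDimensionBound/Lines/affine_multiple.lean`.  This file proves the statement `Stmt.stub_perInvariantTorusBound` of that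
skeleton — «for `n ≥ 3`, a `T¹`-equivariant (exact lifts) affine determinantal representation of `per_n` has size `m ≥ 2^{n-1}`» — in the
FULL form `2^n - 1 ≤ m` (`perInvariantTorusBound_two_pow_sub_one`) and in the registered half form (`stub_perInvariantTorusBound`),
spelled over the Theses-level inline subtorus (`torusGen n 1 (fun _ _ => 1)` unfolded, beta-reduced) so that the skeleton closes its
stub by `exact` (defeq).

**Proof** = the dictionary of crux 18034's line `PairTiedTorusBound`, imported by name, run with the generic element of `T¹`:
rows `p_k = primes₂ (inl k)`, columns `q_j = primes₂ (inr j)` for `j ≠ last`, last column `Ω⁻¹` with `Ω = ∏ p ∏_{j≠last} q`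
(so `∏ d ∏ e = 1`: `PerInvariantLevelNodes.character_eq_one`).  von zur Gathen regularity; exact lift `(P, Q)`; spectral gauge
(`SpectralGauge.exists_spectral_gauge`); kernel weight `γ₀ ≠ 0`, top weight `= (∏ d ∏ e) γ₀ = γ₀`
(`LRPencil.maxGenEigenspace_le_range_of_ne_character`); path expansion in that gauge
(`PathExpansion.neg_dotProduct_pow_mulVec_eq_of_constPart_eq_lamMatrix`); the blocks are weight-graded
(`WeightTyping.carries_homogeneousComponent_one`); level nodes for `T¹` (`PerInvariantLevelNodes.levelDecomp_of_graded_path_expansion`: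
the degrees pin the last column's exponent, so unique factorisation types every node, FULL two-sided `0/1` typing
`TiedLevelDecomposable n 0`); the landed count engine at `k = 0` (`levelBound_of_laplaceOptimal laplaceOptimal_one`) gives
`C(n,s) ≤ w s` at every level, and `grenet_count_of_levels` sums to `2^n - 1 ≤ m`.

HONEST FRAMING: ONE registered stub (the terminal bound, size L) of a forward rung inside route FreeSubtorus; the load-bearing stub
`stub_absorbingSacrifice` and the crux `OrbitDimensionBound` (stmt-16133, target-calibrated) stay OPEN; census-neutral; `VP ≠ VNP`
is NOT proved and nothing here bears on it.
-/

set_option autoImplicit false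

-- the mandated summit-side namespace repeats a component by design (single-problem summit)
set_option linter.dupNamespace false

noncomputable section

open Matrix MvPolynomial Finset Module.End
open scoped Kronecker
open Literature.Computability.AlgebraicComplexity LRPencil
open Summit.ValiantsHypothesis.ValiantsHypothesis.Theorems.RigidityForcesSymmetryPairTiedTorusBound
open Summit.ValiantsHypothesis.ValiantsHypothesis.Theorems.RigidityForcesSymmetryRankRigidMinimalRepr

namespace Summit.ValiantsHypothesis.ValiantsHypothesis.Theorems.FreeSubtorusOrbitDimensionBound

/-- **Grenet's bound `2^n - 1 ≤ m` on the per-invariant torus (full form of the registered stub).**  For `n ≥ 3`, an affine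
determinantal representation of `per_n` over `ℂ` of size `m`, equivariant (exact `GL_m × GL_m` lifts) under the codimension-one
subtorus `T¹ = {x_{kl} ↦ d_k e_l x_{kl} : ∏ d · ∏ e = 1}` of the two-sided torus, has `2^n - 1 ≤ m` — the same bound as for the full
torus (tree theorem `stub_torusBound`).  The dictionary + the `k = 0` count engine, with the generic element of `T¹`.
[cite: LandsbergRessayre2017, Thm. 2.8, §6] [cite: Vonzurgathen1987, Thm. 3.1] -/
theorem perInvariantTorusBound_two_pow_sub_one :
    ∀ (n m : ℕ) (B : Matrix (Fin m) (Fin m) (MvPolynomial (Fin n × Fin n) ℂ)), 3 ≤ n →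
      IsEquivariantDetRepr (Subgroup.closure {γ : Matrix.GeneralLinearGroup (Fin n × Fin n) ℂ |
          ∃ d e : Fin n → ℂˣ, (∀ i : Fin 1, (∏ k, (d k) ^ ((fun (_ : Fin 1) (_ : Fin n ⊕ Fin n) => (1 : ℤ)) i (Sum.inl k))) *
              (∏ l, (e l) ^ ((fun (_ : Fin 1) (_ : Fin n ⊕ Fin n) => (1 : ℤ)) i (Sum.inr l))) = 1) ∧
            (γ : Matrix (Fin n × Fin n) (Fin n × Fin n) ℂ) = Matrix.diagonal (fun p => (d p.1 : ℂ) * (e p.2 : ℂ))})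
        (perPoly (Fin n) ℂ) B →
      2 ^ n - 1 ≤ m := by
  intro n₀ m₀ B hn₀ hB
  classical
  obtain ⟨n, rfl⟩ : ∃ n, n₀ = n + 1 := ⟨n₀ - 1, by omega⟩
  have haff : ∀ r c, (B r c).totalDegree ≤ 1 := hB.1.1
  have hdet : B.det = perPoly (Fin (n + 1)) ℂ := hB.1.2
  have hm₀ : 0 < m₀ := pos_of_det_eq_perPoly (by omega) hdet
  have hreg : IsRegularDetRepr (perPoly (Fin (n + 1)) ℂ) B :=
    hB.isRegular_perPoly vonzurGathen1987_perm_detRepr_rank_holds hn₀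
  have hrank : (constPart B).rank = m₀ - 1 := hreg.2
  -- (1) the generic element of `T¹`
  set Ω : ℕ := (∏ k : Fin (n + 1), primes₂ (n + 1) (Sum.inl k)) *
    ∏ j : Fin n, primes₂ (n + 1) (Sum.inr (Fin.castSucc j)) with hΩ
  have hΩ0 : (Ω : ℂ) ≠ 0 := by
    rw [hΩ]; push_cast
    exact mul_ne_zero (Finset.prod_ne_zero_iff.2 fun k _ => primes₂_cast_ne_zero (n + 1) _)
      (Finset.prod_ne_zero_iff.2 fun j _ => primes₂_cast_ne_zero (n + 1) _)
  set d : Fin (n + 1) → ℂ := fun k => (primes₂ (n + 1) (Sum.inl k) : ℂ) with hd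
  set e : Fin (n + 1) → ℂ := fun j =>
    if j = Fin.last n then (Ω : ℂ)⁻¹ else (primes₂ (n + 1) (Sum.inr j) : ℂ) with he
  have hd0 : ∀ k, d k ≠ 0 := fun k => primes₂_cast_ne_zero (n + 1) _
  have he0 : ∀ j, e j ≠ 0 := fun j => by
    rw [he]; dsimp only
    split_ifs
    · exact inv_ne_zero hΩ0
    · exact primes₂_cast_ne_zero (n + 1) _
  have hchar : (∏ k, d k) * ∏ j, e j = 1 := PerInvariantLevelNodes.character_eq_one
  let γ : GL (Fin (n + 1) × Fin (n + 1)) ℂ :=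
    Matrix.GeneralLinearGroup.kronecker (diagUnit ℂ d hd0) (diagUnit ℂ e he0)
  have hγcoe : (γ : Matrix (Fin (n + 1) × Fin (n + 1)) (Fin (n + 1) × Fin (n + 1)) ℂ) =
      Matrix.diagonal d ⊗ₖ Matrix.diagonal e :=
    coe_kronecker_diagUnit d e hd0 he0
  have hγmem : γ ∈ Subgroup.closure {γ : Matrix.GeneralLinearGroup (Fin (n + 1) × Fin (n + 1)) ℂ |
      ∃ d e : Fin (n + 1) → ℂˣ,
        (∀ i : Fin 1, (∏ k, (d k) ^ ((fun (_ : Fin 1) (_ : Fin (n + 1) ⊕ Fin (n + 1)) => (1 : ℤ)) i (Sum.inl k))) *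
          (∏ l, (e l) ^ ((fun (_ : Fin 1) (_ : Fin (n + 1) ⊕ Fin (n + 1)) => (1 : ℤ)) i (Sum.inr l))) = 1) ∧
        (γ : Matrix (Fin (n + 1) × Fin (n + 1)) (Fin (n + 1) × Fin (n + 1)) ℂ) =
          Matrix.diagonal (fun p => (d p.1 : ℂ) * (e p.2 : ℂ))} := by
    refine Subgroup.subset_closure ⟨fun k => Units.mk0 (d k) (hd0 k), fun j => Units.mk0 (e j) (he0 j), fun _ => ?_, ?_⟩
    · apply Units.ext
      simp only [zpow_one, Units.val_mul, Units.coe_prod, Units.val_mk0, Units.val_one]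
      exact hchar
    · rw [hγcoe, Matrix.diagonal_kronecker_diagonal]
      rfl
  -- its exact lift `(P, Q)`
  obtain ⟨P, Q, hPQ, hΛ⟩ := hB.exists_lift_stabilising hγmem
  have hkj : ∀ v : Fin (n + 1) × Fin (n + 1), (P : Matrix (Fin m₀) (Fin m₀) ℂ) * coeffMat B v =
      (d v.1 * e v.2) • (coeffMat B v * (Q : Matrix (Fin m₀) (Fin m₀) ℂ)) := by
    intro v
    have e1 : coeffMat (Matrix.linSubstEntries γ B) v =
        coeffMat ((P : Matrix (Fin m₀) (Fin m₀) ℂ).map C * B *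
          ((Q⁻¹ : GL (Fin m₀) ℂ) : Matrix (Fin m₀) (Fin m₀) ℂ).map C) v := by rw [hPQ]
    rw [coeffMat_linSubstEntries _ _ haff, hγcoe, sum_kron_diagonal_diagonal_smul,
      coeffMat_C_mul_mul_C] at e1
    rw [mul_eq_of_eq_mul_mul_inv e1, Matrix.smul_mul]
  -- (2) the spectral gauge; kernel weight `≠ 0`; top weight `= (∏ d ∏ e) γ₀ = γ₀`
  obtain ⟨g, h, θ, ρ, i₀, hgU, hhU, hgΛh, hgrade, hρθ, hker, htop⟩ :=
    SpectralGauge.exists_spectral_gauge hm₀ (constPart B) (fun v => coeffMat B v) (fun v => d v.1 * e v.2)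
      (P : Matrix (Fin m₀) (Fin m₀) ℂ) (Q : Matrix (Fin m₀) (Fin m₀) ℂ) hΛ hkj hrank
  have hγ₀ : θ i₀ ≠ 0 := by
    intro h0
    have hQinj : Function.Injective (Matrix.toLin' (Q : Matrix (Fin m₀) (Fin m₀) ℂ)) := fun x y hxy =>
      (Matrix.mulVec_injective_iff_isUnit.2 (Units.isUnit Q)) (by simpa only [Matrix.toLin'_apply] using hxy)
    have hbot := maxGenEigenspace_zero_eq_bot_of_injective _ hQinj
    rw [h0, hbot, le_bot_iff] at hker
    have hK := finrank_ker_toLin'_eq_one hm₀ hrank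
    rw [hker, finrank_bot] at hK
    exact zero_ne_one hK
  have hβ : ρ i₀ = ((∏ i, d i) * ∏ j, e j) * θ i₀ := by
    by_contra hne
    exact htop (maxGenEigenspace_le_range_of_ne_character hm₀ hdet hrank hγcoe hPQ hker (ρ i₀) hne)
  -- (3) the gauged matrix and its path expansion
  obtain ⟨m, rfl⟩ : ∃ m, m₀ = m + 1 := ⟨m₀ - 1, by omega⟩
  set M : Matrix (Fin (m + 1)) (Fin (m + 1)) (MvPolynomial (Fin (n + 1) × Fin (n + 1)) ℂ) :=
    g.map C * B * h.map C with hM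
  have hMdeg : ∀ x y, (M x y).totalDegree ≤ 1 := fun x y => totalDegree_map_C_mul_mul_map_C_le g h haff x y
  have hMdet : M.det = C (g.det * h.det) * perPoly (Fin (n + 1)) ℂ := by
    rw [hM, det_map_C_mul_mul_map_C, hdet]
  have hM0 : constPart M = lamMatrix ℂ i₀ := by
    rw [hM, constPart_mul, constPart_mul, constPart_map_C, constPart_map_C, hgΛh]
  have hκ : g.det * h.det ≠ 0 :=
    mul_ne_zero ((Matrix.isUnit_iff_isUnit_det g).1 hgU).ne_zero ((Matrix.isUnit_iff_isUnit_det h).1 hhU).ne_zero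
  have hMw : ∀ (x y : Fin (m + 1)) (u : Fin (n + 1) × Fin (n + 1)),
      coeff (Finsupp.single u 1) (M x y) ≠ 0 → (d u.1 * e u.2) * θ y = ρ x := by
    intro x y u hu
    rw [← coeffMat_apply, hM, coeffMat_C_mul_mul_C] at hu
    exact (hgrade u x y hu).symm
  have hperm : (perPoly (Fin (n + 1)) ℂ).IsHomogeneous (n + 1) := by
    simpa [Fintype.card_fin] using perPoly_isHomogeneous (n := Fin (n + 1)) (k := ℂ)
  obtain ⟨hpath, -⟩ := PathExpansion.neg_dotProduct_pow_mulVec_eq_of_constPart_eq_lamMatrix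
    (perPoly (Fin (n + 1)) ℂ) (n + 1) hperm (by omega) M hMdeg (g.det * h.det) hMdet i₀ hM0
  set b : Fin m → MvPolynomial (Fin (n + 1) × Fin (n + 1)) ℂ :=
    fun j => homogeneousComponent 1 (M i₀ (i₀.succAbove j)) with hb
  set c : Fin m → MvPolynomial (Fin (n + 1) × Fin (n + 1)) ℂ :=
    fun j => homogeneousComponent 1 (M (i₀.succAbove j) i₀) with hc
  set D : Matrix (Fin m) (Fin m) (MvPolynomial (Fin (n + 1) × Fin (n + 1)) ℂ) :=
    Matrix.of fun j l => -homogeneousComponent 1 (M (i₀.succAbove j) (i₀.succAbove l)) with hD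
  set wv : Fin (n + 1) × Fin (n + 1) → ℂ := fun v => d v.1 * e v.2 with hwv
  set θ' : Fin m → ℂ := fun j => θ (i₀.succAbove j) with hθ'
  have hρθ' : ∀ j, ρ (i₀.succAbove j) = θ' j := fun j => hρθ _ (Fin.succAbove_ne i₀ j)
  have hbw : ∀ s, ∀ δ ∈ (b s).support, (∏ v, wv v ^ δ v) * θ' s = ((∏ i, d i) * ∏ j, e j) * θ i₀ := by
    intro s
    have h1 := WeightTyping.carries_homogeneousComponent_one wv (p := M i₀ (i₀.succAbove s))
      (a := θ' s) (b := ρ i₀) (fun u hu => hMw _ _ u hu)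
    intro δ hδ
    rw [h1 δ hδ, hβ]
  have hcw : ∀ j, ∀ δ ∈ (c j).support, (∏ v, wv v ^ δ v) * θ i₀ = θ' j := fun j =>
    WeightTyping.carries_homogeneousComponent_one wv (p := M (i₀.succAbove j) i₀)
      (a := θ i₀) (b := θ' j) (fun u hu => by rw [← hρθ' j]; exact hMw _ _ u hu)
  have hDw : ∀ j l, ∀ δ ∈ (D j l).support, (∏ v, wv v ^ δ v) * θ' l = θ' j := fun j l => by
    rw [hD, Matrix.of_apply]
    exact WeightTyping.carries_neg wv (WeightTyping.carries_homogeneousComponent_one wv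
      (p := M (i₀.succAbove j) (i₀.succAbove l)) (a := θ' l) (b := θ' j)
      (fun u hu => by rw [← hρθ' j]; exact hMw _ _ u hu))
  have hbh : ∀ j, (b j).IsHomogeneous 1 := fun j => homogeneousComponent_isHomogeneous 1 _
  have hch : ∀ j, (c j).IsHomogeneous 1 := fun j => homogeneousComponent_isHomogeneous 1 _
  have hDh : ∀ j l, (D j l).IsHomogeneous 1 := fun j l => by
    rw [hD, Matrix.of_apply]; exact (homogeneousComponent_isHomogeneous 1 _).neg
  -- (4) level nodes on `T¹`, then the count engine at `k = 0` and the Grenet count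
  obtain ⟨w, hcount, hdec⟩ := PerInvariantLevelNodes.levelDecomp_of_graded_path_expansion b c D hbh hch hDh
    (g.det * h.det) hκ hpath θ' (θ i₀) hγ₀ hbw hcw hDw
  exact grenet_count_of_levels hn₀ w (by rwa [Nat.add_sub_cancel]) fun s hs1 hsn =>
    levelBound_of_laplaceOptimal (k := 0) laplaceOptimal_one (n + 1) (by omega) s (w s) (by omega) (hdec s hs1 hsn)

/-- **Registered stub `stub_perInvariantTorusBound` of line `affine_multiple` (crux stmt-ValiantsHypothesis-16133)**, in its
registered HALF form `2^{n-1} ≤ m`: for `n ≥ 3`, a `T¹`-equivariant (exact lifts) affine determinantal representation of `per_n` has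
size at least `2^{n-1}` (indeed `2^n - 1`, `perInvariantTorusBound_two_pow_sub_one`).  Statement = `Stmt.stub_perInvariantTorusBound`
with `torusGen n 1 (fun _ _ => 1)` unfolded; the skeleton closes its stub by `exact`. [cite: LandsbergRessayre2017, Thm. 2.8, §6]
[cite: Vonzurgathen1987, Thm. 3.1] -/
theorem stub_perInvariantTorusBound :
    ∀ (n m : ℕ) (B : Matrix (Fin m) (Fin m) (MvPolynomial (Fin n × Fin n) ℂ)), 3 ≤ n →
      IsEquivariantDetRepr (Subgroup.closure {γ : Matrix.GeneralLinearGroup (Fin n × Fin n) ℂ |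
          ∃ d e : Fin n → ℂˣ, (∀ i : Fin 1, (∏ k, (d k) ^ ((fun (_ : Fin 1) (_ : Fin n ⊕ Fin n) => (1 : ℤ)) i (Sum.inl k))) *
              (∏ l, (e l) ^ ((fun (_ : Fin 1) (_ : Fin n ⊕ Fin n) => (1 : ℤ)) i (Sum.inr l))) = 1) ∧
            (γ : Matrix (Fin n × Fin n) (Fin n × Fin n) ℂ) = Matrix.diagonal (fun p => (d p.1 : ℂ) * (e p.2 : ℂ))})
        (perPoly (Fin n) ℂ) B →
      2 ^ (n - 1) ≤ m := by
  intro n m B hn hB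
  have h := perInvariantTorusBound_two_pow_sub_one n m B hn hB
  have h2 : 2 ^ n = 2 * 2 ^ (n - 1) := by
    rw [← pow_succ']; congr 1; omega
  have h3 : 1 ≤ 2 ^ (n - 1) := Nat.one_le_two_pow
  omega

end Summit.ValiantsHypothesis.ValiantsHypothesis.Theorems.FreeSubtorusOrbitDimensionBound

end
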